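import Mathlib
import Literature.NumberTheory.LFunctions.WeilArchDensityTail
import Literature.NumberTheory.LFunctions.WeilWindowSuzukiProofs
import HarnessLib

/-!
# The archimedean budget of a linear-modulus class: `∫₀^∞ ρ_∞(t) min(2, t/h) dt ≤ log(1/h) + 5`

Helper file (`--supports stmt-RiemannHypothesis-0098`, lead-track anchor: Weil-positivity window ladder, format-C far bound),
pure proofs, RH-free.  Seat rh-explicit-weil-1 gen11 (memo `run/shared/lean/pub/rh-explicit/rh-explicit-weil-1/FORMAT-K3.md` §12.6).

In the RH anatomy of the prime-shift form (`WeilFarFloorRHCeiling`) the archimedean energy of a test `g` is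
`∫_{(0,∞)} ρ_∞(t) D_t(g) dt`, `ρ_∞ = weilArchDensity = e^{t/2}/(2 sinh t)`.  For the RMS envelope of `WeilFarFloorEnvelope` with the box
weight of width `h` one has `D_t ≤ min(2, t/h)·N` (`N = ∫g²`, `WeilFarFloorEnvelopeModulus`); this file evaluates the resulting budget
(Literature only: `weilArchDensityG_le` (`tρ_∞(t) ≤ t + ½`), `integrableOn_weilArchDensity_Ioi`, and the closed form of the tail
`weilArchTail_eq_log`):

* `weilArchTail_le_half_log` : `Ψ(h) = ∫_h^∞ ρ_∞ ≤ ½ log(1/h) + 2` for `0 < h ≤ 1`;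
* `archBudget_integrableOn`, `archBudget_le` : `t ↦ ρ_∞(t)·min(2N, tN/h)` is integrable on `(0, ∞)` with integral `≤ (log(1/h) + 5)·N`.

With `h = e^{−a}` this is the `a + O(1)` archimedean loss of the route «RH ⟹ λ_max(a) ≤ e^a + 3a + O(1)».  Standard axioms only.
-/

set_option linter.dupNamespace false
set_option autoImplicit false

noncomputable section

open MeasureTheory Set Filter
open scoped Real Topology

namespace Summit.RiemannHypothesis.RiemannHypothesis.Theorems.WeilFormatC

namespace FloorEnvelope

open Literature.NumberTheory.LFunctions Literature.Analysis.ValidatedNumerics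

/-! ## §1 The tail of the archimedean density below `t = 1` -/

/-- `φ(u) = (1 − e^{−u})/u ≥ e^{−u}` for `u > 0` (i.e. `e^u − 1 ≥ u`). -/
theorem exp_neg_le_phiExp {u : ℝ} (hu : 0 < u) : Real.exp (-u) ≤ PolyMP.phiExp u := by
  rw [PolyMP.phiExp, if_neg hu.ne', le_div_iff₀ hu]
  have h1 := Real.add_one_le_exp u
  have h2 : Real.exp (-u) * Real.exp u = 1 := by rw [← Real.exp_add]; simp
  have h3 : 0 < Real.exp (-u) := Real.exp_pos _
  nlinarith

/-- **The archimedean tail is at most `½ log(1/h) + 2` on `(0, 1]`** (closed form `weilArchTail_eq_log` with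
`log(1 + e^{−h/2}) ≤ log 2`, `−log φ(h/2) ≤ h/2`, `arctan ≤ π/4`). -/
theorem weilArchTail_le_half_log {h : ℝ} (hh0 : 0 < h) (hh1 : h ≤ 1) :
    weilArchTail h ≤ (1 / 2) * Real.log (1 / h) + 2 := by
  rw [weilArchTail_eq_log hh0]
  have hq0 : 0 < Real.exp (-(h / 2)) := Real.exp_pos _
  have hq1 : Real.exp (-(h / 2)) ≤ 1 := Real.exp_le_one_iff.2 (by linarith)
  have h1 : Real.log (1 + Real.exp (-(h / 2))) ≤ Real.log 2 :=
    Real.log_le_log (by linarith) (by linarith)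
  have h2 : Real.arctan (Real.exp (-(h / 2))) ≤ π / 4 := by
    rw [← Real.arctan_one]; exact Real.arctan_strictMono.monotone hq1
  have h3 : -(h / 2) ≤ Real.log (PolyMP.phiExp (h / 2)) := by
    have := Real.log_le_log hq0 (exp_neg_le_phiExp (by linarith : 0 < h / 2))
    rwa [Real.log_exp] at this
  have h4 : Real.log (1 / h) = -Real.log h := by rw [one_div, Real.log_inv]
  have hl2 := Real.log_two_lt_d9
  have hpi := Real.pi_lt_d2
  rw [h4]
  linarith

/-! ## §2 The budget `∫ ρ_∞ min(2N, tN/h)` -/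

/-- The majorant `ρ_∞(t)·min(2N, tN/h)` is integrable on `(0, h]` and its integral there is `≤ N` (`tρ_∞(t) ≤ t + ½`, `h ≤ 1`). -/
theorem archBudget_small {h N : ℝ} (hh0 : 0 < h) (hh1 : h ≤ 1) (hN : 0 ≤ N) :
    IntegrableOn (fun t ↦ weilArchDensity t * min (2 * N) (t / h * N)) (Ioc 0 h) ∧
      ∫ t in Ioc 0 h, weilArchDensity t * min (2 * N) (t / h * N) ≤ N := by
  have hmeas : Measurable (fun t ↦ weilArchDensity t * min (2 * N) (t / h * N)) :=
    measurable_weilArchDensity.mul ((measurable_const).min ((measurable_id.div_const h).mul_const N))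
  -- pointwise on `(0, h]`: `0 ≤ m(t) ≤ (N/h)(t + ½) ≤ (N/h)(h + ½)`
  have hpt : ∀ t ∈ Ioc (0 : ℝ) h, 0 ≤ weilArchDensity t * min (2 * N) (t / h * N) ∧
      weilArchDensity t * min (2 * N) (t / h * N) ≤ N / h * (t + 1 / 2) := by
    intro t ht
    have hρ := weilArchDensity_pos ht.1
    have hmin0 : 0 ≤ min (2 * N) (t / h * N) := le_min (by linarith) (by
      have : 0 ≤ t / h := div_nonneg ht.1.le hh0.le; positivity)
    refine ⟨mul_nonneg hρ.le hmin0, ?_⟩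
    have hG := weilArchDensityG_le ht.1.le
    rw [weilArchDensityG_of_ne ht.1.ne'] at hG
    calc weilArchDensity t * min (2 * N) (t / h * N) ≤ weilArchDensity t * (t / h * N) :=
          mul_le_mul_of_nonneg_left (min_le_right _ _) hρ.le
      _ = N / h * (t * weilArchDensity t) := by field_simp
      _ ≤ N / h * (t + 1 / 2) := mul_le_mul_of_nonneg_left hG (div_nonneg hN hh0.le)
  have hint : IntegrableOn (fun t ↦ weilArchDensity t * min (2 * N) (t / h * N)) (Ioc 0 h) := by
    have hconst : IntegrableOn (fun _ : ℝ ↦ N / h * (h + 1 / 2)) (Ioc 0 h) :=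
      integrableOn_const (by simp [Real.volume_Ioc])
    refine Integrable.mono' hconst hmeas.aestronglyMeasurable.restrict ?_
    refine (ae_restrict_mem measurableSet_Ioc).mono fun t ht ↦ ?_
    obtain ⟨h0, hle⟩ := hpt t ht
    rw [Real.norm_eq_abs, abs_of_nonneg h0]
    refine hle.trans (mul_le_mul_of_nonneg_left (by linarith [ht.2]) (div_nonneg hN hh0.le))
  refine ⟨hint, ?_⟩
  have hdom : IntegrableOn (fun t : ℝ ↦ N / h * (t + 1 / 2)) (Ioc 0 h) :=
    (continuous_const.mul (continuous_id.add continuous_const)).integrableOn_Icc.mono_set Ioc_subset_Icc_self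
  calc ∫ t in Ioc 0 h, weilArchDensity t * min (2 * N) (t / h * N)
      ≤ ∫ t in Ioc 0 h, N / h * (t + 1 / 2) :=
        setIntegral_mono_on hint hdom measurableSet_Ioc fun t ht ↦ (hpt t ht).2
    _ = N / h * (h ^ 2 / 2 + h / 2) := by
        rw [integral_const_mul]
        congr 1
        have i1 : IntervalIntegrable (fun x : ℝ ↦ x) volume 0 h := continuous_id'.intervalIntegrable _ _
        have i2 : IntervalIntegrable (fun _ : ℝ ↦ (1 / 2 : ℝ)) volume 0 h := intervalIntegrable_const
        rw [← intervalIntegral.integral_of_le hh0.le, intervalIntegral.integral_add i1 i2, integral_id,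
          intervalIntegral.integral_const, smul_eq_mul]
        ring
    _ = N * ((h + 1) / 2) := by field_simp
    _ ≤ N := by nlinarith

/-- The majorant is integrable on `(h, ∞)` with integral `≤ 2N·Ψ(h)`. -/
theorem archBudget_large {h N : ℝ} (hh0 : 0 < h) (hN : 0 ≤ N) :
    IntegrableOn (fun t ↦ weilArchDensity t * min (2 * N) (t / h * N)) (Ioi h) ∧
      ∫ t in Ioi h, weilArchDensity t * min (2 * N) (t / h * N) ≤ 2 * N * weilArchTail h := by
  have hmeas : Measurable (fun t ↦ weilArchDensity t * min (2 * N) (t / h * N)) :=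
    measurable_weilArchDensity.mul ((measurable_const).min ((measurable_id.div_const h).mul_const N))
  have hρi := integrableOn_weilArchDensity_Ioi hh0
  have hpt : ∀ t ∈ Ioi h, 0 ≤ weilArchDensity t * min (2 * N) (t / h * N) ∧
      weilArchDensity t * min (2 * N) (t / h * N) ≤ 2 * N * weilArchDensity t := by
    intro t ht
    have ht0 : 0 < t := hh0.trans ht
    have hρ := weilArchDensity_pos ht0
    have hmin0 : 0 ≤ min (2 * N) (t / h * N) := le_min (by linarith) (by
      have : 0 ≤ t / h := div_nonneg ht0.le hh0.le; positivity)
    refine ⟨mul_nonneg hρ.le hmin0, ?_⟩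
    calc weilArchDensity t * min (2 * N) (t / h * N) ≤ weilArchDensity t * (2 * N) :=
          mul_le_mul_of_nonneg_left (min_le_left _ _) hρ.le
      _ = 2 * N * weilArchDensity t := by ring
  have hdom : IntegrableOn (fun t ↦ 2 * N * weilArchDensity t) (Ioi h) := hρi.const_mul _
  have hint : IntegrableOn (fun t ↦ weilArchDensity t * min (2 * N) (t / h * N)) (Ioi h) := by
    refine Integrable.mono' hdom hmeas.aestronglyMeasurable.restrict ?_
    refine (ae_restrict_mem measurableSet_Ioi).mono fun t ht ↦ ?_
    obtain ⟨h0, hle⟩ := hpt t ht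
    rw [Real.norm_eq_abs, abs_of_nonneg h0]
    exact hle
  refine ⟨hint, ?_⟩
  calc ∫ t in Ioi h, weilArchDensity t * min (2 * N) (t / h * N)
      ≤ ∫ t in Ioi h, 2 * N * weilArchDensity t := setIntegral_mono_on hint hdom measurableSet_Ioi fun t ht ↦ (hpt t ht).2
    _ = 2 * N * weilArchTail h := by rw [integral_const_mul]; rfl

/-- **The archimedean budget of the linear-modulus class**: for `0 < h ≤ 1` and `N ≥ 0` the majorant `t ↦ ρ_∞(t)·min(2N, tN/h)`
is integrable on `(0, ∞)`. -/
theorem archBudget_integrableOn {h N : ℝ} (hh0 : 0 < h) (hh1 : h ≤ 1) (hN : 0 ≤ N) :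
    IntegrableOn (fun t ↦ weilArchDensity t * min (2 * N) (t / h * N)) (Ioi 0) := by
  rw [← Ioc_union_Ioi_eq_Ioi hh0.le]
  exact (archBudget_small hh0 hh1 hN).1.union (archBudget_large hh0 hN).1

/-- **… and its integral is at most `(log(1/h) + 5)·N`.** -/
theorem archBudget_le {h N : ℝ} (hh0 : 0 < h) (hh1 : h ≤ 1) (hN : 0 ≤ N) :
    ∫ t in Ioi 0, weilArchDensity t * min (2 * N) (t / h * N) ≤ (Real.log (1 / h) + 5) * N := by
  obtain ⟨i1, b1⟩ := archBudget_small hh0 hh1 hN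
  obtain ⟨i2, b2⟩ := archBudget_large hh0 hN
  rw [← Ioc_union_Ioi_eq_Ioi hh0.le, setIntegral_union (Ioc_disjoint_Ioi le_rfl) measurableSet_Ioi i1 i2]
  have hΨ := weilArchTail_le_half_log hh0 hh1
  have hlog : 0 ≤ Real.log (1 / h) := Real.log_nonneg (by rw [le_div_iff₀ hh0]; linarith)
  nlinarith [mul_le_mul_of_nonneg_left hΨ (by linarith : 0 ≤ 2 * N)]

end FloorEnvelope

end Summit.RiemannHypothesis.RiemannHypothesis.Theorems.WeilFormatC
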